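/- Copyright: the b2b-balaban cell (near-miss cell 7), T⁴-continuum fan-out; row NE7b CRUX team (2), seat
t4-ne7b-formalise-leaf-05 (gen 34) — IR-46-2's standing division «… leaf-05 toy-instantiates» applied to leaf-02 g31's
IR-50-2 part 2 «THE KEY-SIDE DECORATION INSTANCE AT THE RECORD» (`HistoryRealiseCellsRunAssemblyWTVSDataLWK`, OWNER g51
W-ne7bp1-g51-1), part 10 of the sanity series (`CLAIMS.log` l.34788).  Released under the licence of the surrounding project. -/
import Summits.QuantumFields.BalabanUV.T4Continuum.Support.HistoryRealiseCellsRunAssemblyWTVSSanityLWD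
import Summits.QuantumFields.BalabanUV.T4Continuum.Support.HistoryRealiseCellsRunAssemblyWTVSDataLWK

/-!
# Sanity for the (α) assembly, part 10: THE KEY-SIDE RECORD `HistReadDataLWK` — THE JUNCTION `toLWK` (an LW record plus the
twelve key-side items ON ITS OWN LETTERS is an LWK record) AND «MERGERS COUNT AT MOST ONE» FROM THE SHARE CHECK AS TYPED
(companion of `HistoryRealiseCellsRunAssemblyWTVSDataLWK`; lineage `t4-ne7b-formalise-leaf-05` gen 34)

Summits-side support leaf of the T⁴-continuum cell (rung (B)+1 on a FINITE torus only; NOT infinite volume, NOT the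
mass gap, NOT Clay; NOT a proof of NE7b — NOT PRINTED, NOT PROVED).  [folklore] over part 9 and leaf-02 g31's IR-50-2
FILE 1, REUSED BY NAME; ONE generic `def` (`HistReadDataLW.toLWK`: 119 copies + the twelve key-side items — what a key-side
supplier owes ON TOP of an LW record, by name) and two by-name consequences of FILE 1; nothing printed asserted, no
`def … : Prop` fact, no cite-tagged hypothesis, zero `sorry`.  The toy inhabitant is part 11 (`…SanityLWKToy`); FILE 2's
`HistReadDataLWK.toLWD` ∕ §2 run on it is part 12 (`…SanityLWKEnd`).

§12 **`HistReadDataLW.toLWK (Dl) (kdC kdN kdDec kdV) (kdDied kdMem kdInj kdV0 kdEnv kdW kdCN kdShare) : HistReadDataLWK … β …`**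
— the four data and eight displays typed VERBATIM as FILE 1's fields at `Dl.ℛ Dl.Φf Dl.l₀ Dl.K₀ Dl.W Dl.φB Dl.φR` (the
converse direction of leaf-02's FILE 2 `HistReadDataLWK.toLWD`, which FORGETS the key side into `decor :=
indexDecor_of_keySide …`); `toLWK_data` (rfl ×12).
§12b **`HistReadDataLWK.kdN_le_one_of_merger`**: on ANY key-side record, at an event that is neither a birth nor a renewal
the share check `kdShare` reads `kdN K e ≤ exp 0`, so `kdN K e ≤ 1`; with the count display `kdCN`,
**`card_kdC_le_one_of_merger`**: every merger event of a member of a bad key class carries AT MOST ONE choice word.  The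
merger normalisation of R-OWNER-50-1 («mergers write nothing», `N K (·,2,·) = 1`, a singleton word) is thus the MOST the
record AS TYPED allows — located, no new hypothesis.

HONEST.  A junction and two one-line consequences over OUR carriers; nothing about Bałaban's index reading (ρ1), envelopes
(ρ2) or the share check's VALUES (ρ3, «FIBRE-1» closed as served); BY-NAME EFFECT ON THE WALL: NONE; NE7b NOT proved;
spine 0∕9.  HONEST DEPENDENCY (cell): continuum YM on T⁴ ⇐ BetaPertH ∧ nine spine estimates (0/9 proved); BetaPertH ⇐
(D1) ∧ (D4) ∧ CAP+tail; G-an2-4 gates asym, D1 and NE2/3/4.  Unchanged here.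
-/

open Finset MeasureTheory
open Literature.MathematicalPhysics.QuantumFieldTheory.Balaban1983to89
open T4PersistenceDictionary T4PersistentHistoryCount T4BankedInduction T4PrintedShapeBanking
open T4WeightBudget T4GlobalDenominator T4LiveClassFibration T4LiveStructureGas T4LiveGasToTerms T4RecordPriceSeam
open T4PartnerMultiplicity T4IndicatorShell T4MatchingAssembly T4MatchingClosure T4MatchingClosureSocket T4Continuum
open T4StabilitySocket T4BranchingRecordsGas T4TaggedShapeBanking T4CanonicalMenus T4RenewalChains
open Literature.MathematicalPhysics.QuantumFieldTheory.Balaban1983to89.B13ScaleTransfer (Pt)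
open Summit.QuantumFields.BalabanUV.T4Continuum.HistoryFlow Summit.QuantumFields.BalabanUV.T4Continuum.HistoryGen
open Summit.QuantumFields.BalabanUV.T4Continuum.HistoryGenealogyRealise
open Summit.QuantumFields.BalabanUV.T4Continuum.HistoryGenealogyInstantiate
open Summit.QuantumFields.BalabanUV.T4Continuum.HistoryAssemblyTerms
open Summit.QuantumFields.BalabanUV.T4Continuum.HistoryAssemblyMult Summit.QuantumFields.BalabanUV.T4Continuum.HistoryAssemblyMultKey
open Summit.QuantumFields.BalabanUV.T4Continuum.HistorySocketTH
open Summit.QuantumFields.BalabanUV.T4Continuum.HistoryRealiseCellsRunApexT3bWTVS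
open Summit.QuantumFields.BalabanUV.T4Continuum.HistoryRealiseCellsRunApexT3bWTVSL
open Summit.QuantumFields.BalabanUV.T4Continuum.B16HistoryIndexedRepr
open Summit.QuantumFields.BalabanUV.T4Continuum.B16HistoryIndexedTrunc
open Summit.QuantumFields.BalabanUV.T4Continuum.HistoryConstants Summit.QuantumFields.BalabanUV.T4Continuum.HistoryBankingDiscountCharge
open Summit.QuantumFields.BalabanUV.T4Continuum.HistoryBankingCreditRead
open Summit.QuantumFields.BalabanUV.T4Continuum.HistoryBankingFibreRoom
open Summit.QuantumFields.BalabanUV.T4Continuum.HistoryBankingFibreResum (ncount ncount_born ncount_renew ncount_merge)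
open Summit.QuantumFields.BalabanUV.T4Continuum.HistoryPriceNodeSum Summit.QuantumFields.BalabanUV.T4Continuum.HistoryPriceKeys
open Summit.QuantumFields.BalabanUV.T4Continuum.HistoryRealiseCellsRunSupplyWTVS
open Summit.QuantumFields.BalabanUV.T4Continuum.HistoryRealiseCellsRunSupplyKeysWTVS
open Summit.QuantumFields.BalabanUV.T4Continuum.HistoryRealiseCellsRunSupplyWTVSSanity
open Summit.QuantumFields.BalabanUV.T4Continuum.HistoryRealiseCellsRunAssemblyWTVSData
open Summit.QuantumFields.BalabanUV.T4Continuum.HistoryRealiseCellsRunAssemblyWTVSDataL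
open Summit.QuantumFields.BalabanUV.T4Continuum.HistoryRealiseCellsRunAssemblyWTVSDataLW
open Summit.QuantumFields.BalabanUV.T4Continuum.HistoryRealiseCellsRunAssemblyWTVSDataLWD
open Summit.QuantumFields.BalabanUV.T4Continuum.HistoryRealiseCellsRunAssemblyWTVSDataLWK
open Summit.QuantumFields.BalabanUV.T4Continuum.HistoryRealiseCellsRunAssemblyWTVSLW
open Summit.QuantumFields.BalabanUV.T4Continuum.HistoryRealiseCellsRunAssemblyWTVSLWD
open Summit.QuantumFields.BalabanUV.T4Continuum.HistoryRealiseCellsRunSupplyFibreWTVS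
open Summit.QuantumFields.BalabanUV.T4Continuum.HistoryRealiseCellsRunSupplyFibreKeysWTVS
open Summit.QuantumFields.BalabanUV.T4Continuum.HistoryBankingFibreDecorKeys Summit.QuantumFields.BalabanUV.T4Continuum.HistoryBankingFibreDecorSlice
open Summit.QuantumFields.BalabanUV.T4Continuum.HistoryRealiseCellsRunApexWitness
open Summit.QuantumFields.BalabanUV.T4Continuum.HistoryBankingSharpShares (ell sBsharp)
open Summit.QuantumFields.BalabanUV.T4Continuum.HistoryBankingRoundingUnrounded (sRunr ApFlat)
open Summit.QuantumFields.BalabanUV.T4Continuum.HistoryBankingRoundingSupply (ellStar)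
open Summit.QuantumFields.BalabanUV.T4Continuum.HistoryBankingVolumeWindow (uvol lamVol jvol)
open Summit.QuantumFields.BalabanUV.T4Continuum.HistoryBankingVolumeSupply (ellVol)
open Missing AveragingRT

namespace Summit.QuantumFields.BalabanUV.T4Continuum.HistoryRealiseCellsRunAssemblyWTVSSanity

noncomputable section

open B16HistoryIndexedRepr.Sanity B16HistoryIndexedRepr.SanityInput HistoryConstants.Sanity

set_option synthInstance.maxSize 1024

/-! ## §12 The junction: an LW record plus the twelve key-side items on its own letters is an LWK record -/

section Junction

variable {F : T4Family} {G : Type*} [GaugeGroup G] [MeasurableSpace G] [HaarData G] [RegularGaugeGroup G]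
  {D : FiniteEpsData F G} {C : T4PrintedShapeBanking.Consts} {O : PrintedO1s} {θv : ℝ} {rr d n : ℕ} {hn : 0 < n}
  {g₀ : ℕ → ℝ} {os : List (ULoop F)} {cΛ Lr Φ β₀ : ℝ} {p₁ η η' κ κ₂ κᵥ : ℕ} {DomK : ℕ → Type}
  {I : (K : ℕ) → HIndex (DomK K)} [DecidableEq (HIndex.Idx I)] {DomK' : ℕ → Type} {I' : (K : ℕ) → HIndex (DomK' K)}
  {Xs : ℕ → Type} [∀ K, MeasurableSpace (Xs K)] {μ : (K : ℕ) → Measure (Xs K)} [∀ K, IsFiniteMeasure (μ K)]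
  {𝒢 : (K : ℕ) → GoodClass (Xs K)} {Y : ℕ → Type} [∀ K, MeasurableSpace (Y K)] {νB : (K : ℕ) → Measure (Y K)}
  [∀ K, IsFiniteMeasure (νB K)] {𝒢' : (K : ℕ) → GoodClass (Y K)} {β : Type} [DecidableEq β]

omit [RegularGaugeGroup G] in
/-- **THE KEY-SIDE JUNCTION**: a prefix-twin record `HistReadDataLW` together with the twelve key-side items of IR-50-2 ON ITS
OWN reading, letters, radius, threshold, envelope and shares — four data `kdC kdN kdDec kdV` and eight displays `kdDied`
(ρ0), `kdMem kdInj` (ρ1), `kdV0 kdEnv kdW` (ρ2), `kdCN kdShare` (ρ3), each typed VERBATIM as the corresponding field of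
`HistReadDataLWK` — IS a key-side record `HistReadDataLWK … β …`: 119 fields copied, the twelve filled.  What a key-side
supplier owes ON TOP of an LW record, by name. [folklore] -/
def _root_.Summit.QuantumFields.BalabanUV.T4Continuum.HistoryRealiseCellsRunAssemblyWTVSDataLW.HistReadDataLW.toLWK
    (Dd : HistReadDataLW D C O θv rr d n hn g₀ os cΛ Lr Φ β₀ p₁ η η' κ κ₂ κᵥ I I' Xs μ 𝒢 Y νB 𝒢')
    (kdC : ℕ → (Fin d → ℕ) × Gen PEv × Multiset (PEv × ((Fin d → ℕ) × Finset (Pt d))) → PEv → Finset β)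
    (kdN : ℕ → PEv → ℕ)
    (kdDec : ℕ → HIndex.Idx I → (Fin d → ℕ) × Gen PEv × Multiset (PEv × ((Fin d → ℕ) × Finset (Pt d))) → Gen (PEv × β))
    (kdV : ℕ → ℝ → Finset ((Fin d → ℕ) × Gen PEv × Multiset (PEv × ((Fin d → ℕ) × Finset (Pt d)))) → SIdx I → ℝ)
    (kdDied : ∀ K, Dd.K₀ ≤ K → ∀ τ ∈ HIndex.termSet I K, ∀ j, j < K → (Dd.ℛ.inputOf.run K τ).histV.died j = ∅)
    (kdMem : ∀ K, Dd.K₀ ≤ K →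
      ∀ k ∈ badGMems (memA n F.L Dd.ℛ) jhalf (HIndex.termSet I)
          (kmemA n F.L hn (lt_of_lt_of_le (by norm_num) (two_le_L F)) Dd.ℛ) K,
        ∀ τ ∈ fibre (kmemA n F.L hn (lt_of_lt_of_le (by norm_num) (two_le_L F)) Dd.ℛ) (HIndex.termSet I) K k,
          ∀ w ∈ k, kdDec K τ w ∈ decG (kdC K w) w.2.1)
    (kdInj : ∀ K, Dd.K₀ ≤ K →
      ∀ k ∈ badGMems (memA n F.L Dd.ℛ) jhalf (HIndex.termSet I)
          (kmemA n F.L hn (lt_of_lt_of_le (by norm_num) (two_le_L F)) Dd.ℛ) K,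
        ∀ (a : (I K).Adm) (c : (I K).HC) (p p' : (I K).HZ × (I K).HL),
          (⟨K, a, (p.1, p.2, c)⟩ : HIndex.Idx I) ∈
              fibre (kmemA n F.L hn (lt_of_lt_of_le (by norm_num) (two_le_L F)) Dd.ℛ) (HIndex.termSet I) K k →
          (⟨K, a, (p'.1, p'.2, c)⟩ : HIndex.Idx I) ∈
              fibre (kmemA n F.L hn (lt_of_lt_of_le (by norm_num) (two_le_L F)) Dd.ℛ) (HIndex.termSet I) K k →
          (∀ w ∈ k, kdDec K ⟨K, a, (p.1, p.2, c)⟩ w = kdDec K ⟨K, a, (p'.1, p'.2, c)⟩ w) → p = p')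
    (kdV0 : ∀ K t k, ∀ s ∈ CslOf I (kmemA n F.L hn (lt_of_lt_of_le (by norm_num) (two_le_L F)) Dd.ℛ) K k,
      0 ≤ kdV K t k s)
    (kdEnv : ∀ K t, |t| ≤ Dd.l₀ → Dd.K₀ ≤ K →
      ∀ k ∈ badGMems (memA n F.L Dd.ℛ) jhalf (HIndex.termSet I)
          (kmemA n F.L hn (lt_of_lt_of_le (by norm_num) (two_le_L F)) Dd.ℛ) K,
        ∀ (a : (I K).Adm) (h : (I K).HZ) (l : (I K).HL) (c : (I K).HC),
          (⟨K, a, (h, l, c)⟩ : HIndex.Idx I) ∈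
              fibre (kmemA n F.L hn (lt_of_lt_of_le (by norm_num) (two_le_L F)) Dd.ℛ) (HIndex.termSet I) K k →
            |Dd.Φf.wC K t a c| * Real.exp (Dd.Φf.BV K t a h l c) ≤ kdV K t k ⟨K, a, c⟩)
    (kdW : ∀ K t, |t| ≤ Dd.l₀ → Dd.K₀ ≤ K →
      ∀ k ∈ badGMems (memA n F.L Dd.ℛ) jhalf (HIndex.termSet I)
          (kmemA n F.L hn (lt_of_lt_of_le (by norm_num) (two_le_L F)) Dd.ℛ) K,
        ∑ s ∈ CslOf I (kmemA n F.L hn (lt_of_lt_of_le (by norm_num) (two_le_L F)) Dd.ℛ) K k, kdV K t k s ≤ Dd.W K)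
    (kdCN : ∀ K, Dd.K₀ ≤ K →
      ∀ k ∈ badGMems (memA n F.L Dd.ℛ) jhalf (HIndex.termSet I)
          (kmemA n F.L hn (lt_of_lt_of_le (by norm_num) (two_le_L F)) Dd.ℛ) K,
        ∀ w ∈ k, ∀ e ∈ w.2.1.events, (kdC K w e).card ≤ kdN K e)
    (kdShare : ∀ K e, ((kdN K e : ℕ) : ℝ) ≤ Real.exp (sharpT (Dd.φB K) (Dd.φR K) e)) :
    HistReadDataLWK D C O θv rr d n hn g₀ os cΛ Lr Φ β₀ p₁ η η' κ κ₂ κᵥ β I I' Xs μ 𝒢 Y νB 𝒢' where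
  l₀ := Dd.l₀
  vol := Dd.vol
  l₀_pos := Dd.l₀_pos
  vol_pos := Dd.vol_pos
  K₀ := Dd.K₀
  RA := Dd.RA
  ρA := Dd.ρA
  holdsA := Dd.holdsA
  intA := Dd.intA
  H2A := Dd.H2A
  ℛ := Dd.ℛ
  hL := Dd.hL
  hs := Dd.hs
  Φf := Dd.Φf
  hR := Dd.hR
  isRj := Dd.isRj
  one_le_R := Dd.one_le_R
  hL4 := Dd.hL4
  hprof := Dd.hprof
  hdrop := Dd.hdrop
  hN := Dd.hN
  hRm := Dd.hRm
  hRmS := Dd.hRmS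
  hRm2 := Dd.hRm2
  hD := Dd.hD
  hreg := Dd.hreg
  hn₁ := Dd.hn₁
  hE₂ := Dd.hE₂
  hE₃pos := Dd.hE₃pos
  sB := Dd.sB
  φB := Dd.φB
  φR := Dd.φR
  β' := Dd.β'
  hF := Dd.hF
  h29 := Dd.h29
  W := Dd.W
  one_le_W := Dd.one_le_W
  Wi := Dd.Wi
  BAi := Dd.BAi
  mi := Dd.mi
  hWi := Dd.hWi
  hBA := Dd.hBA
  hmi := Dd.hmi
  kdC := kdC
  kdN := kdN
  kdDec := kdDec
  kdV := kdV
  kdDied := kdDied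
  kdMem := kdMem
  kdInj := kdInj
  kdV0 := kdV0
  kdEnv := kdEnv
  kdW := kdW
  kdCN := kdCN
  kdShare := kdShare
  c₀ := Dd.c₀
  n₁ := Dd.n₁
  c₀_pos := Dd.c₀_pos
  floor := Dd.floor
  floor' := Dd.floor'
  sites := Dd.sites
  sites' := Dd.sites'
  RB := Dd.RB
  ρB := Dd.ρB
  holdsB := Dd.holdsB
  intB := Dd.intB
  H2B := Dd.H2B
  trunc := Dd.trunc
  htr := Dd.htr
  dB := Dd.dB
  mup := Dd.mup
  sB' := Dd.sB'
  φB' := Dd.φB'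
  φR' := Dd.φR'
  upB := Dd.upB
  deadB_nonneg := Dd.deadB_nonneg
  resumB := Dd.resumB
  mup_bd := Dd.mup_bd
  shA := Dd.shA
  shB := Dd.shB
  Wsh := Dd.Wsh
  shell := Dd.shell
  Cc := Dd.Cc
  Rr := Dd.Rr
  CcRec := Dd.CcRec
  RrRec := Dd.RrRec
  ν := Dd.ν
  u := Dd.u
  s₂ := Dd.s₂
  q₀ := Dd.q₀
  r := Dd.r
  s := Dd.s
  budget := Dd.budget
  sum_r := Dd.sum_r
  sum_u := Dd.sum_u
  sum_s := Dd.sum_s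
  sum_s₂ := Dd.sum_s₂
  hcΛ := Dd.hcΛ
  hΛ := Dd.hΛ
  hθv := Dd.hθv
  hβ₀ := Dd.hβ₀
  hLr := Dd.hLr
  hΦ := Dd.hΦ
  m := Dd.m
  hm := Dd.hm
  hexpR := Dd.hexpR
  hexpR' := Dd.hexpR'
  hexpB := Dd.hexpB
  hexpF := Dd.hexpF
  hexpV := Dd.hexpV
  hη := Dd.hη
  hη' := Dd.hη'
  hκ := Dd.hκ
  hκ₂ := Dd.hκ₂
  hκᵥ := Dd.hκᵥ
  hp₀ := Dd.hp₀
  hAp := Dd.hAp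
  hγ₀ := Dd.hγ₀
  hA₁ := Dd.hA₁
  hA₀ := Dd.hA₀
  hM := Dd.hM
  hβd := Dd.hβd
  hφB := Dd.hφB
  hφR := Dd.hφR
  hφB' := Dd.hφB'
  hφR' := Dd.hφR'
  hsB := Dd.hsB
  hsB' := Dd.hsB'
  p27 := Dd.p27
  hp27 := Dd.hp27
  h27 := Dd.h27

omit [RegularGaugeGroup G] in
/-- the junction keeps the reading, the threshold, the factor data, the source radius, the envelope, the share letters and
the truncation; its key-side data are the given ones (`rfl`) [folklore] -/
theorem toLWK_data (Dd : HistReadDataLW D C O θv rr d n hn g₀ os cΛ Lr Φ β₀ p₁ η η' κ κ₂ κᵥ I I' Xs μ 𝒢 Y νB 𝒢')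
    (kdC : ℕ → (Fin d → ℕ) × Gen PEv × Multiset (PEv × ((Fin d → ℕ) × Finset (Pt d))) → PEv → Finset β)
    (kdN : ℕ → PEv → ℕ)
    (kdDec : ℕ → HIndex.Idx I → (Fin d → ℕ) × Gen PEv × Multiset (PEv × ((Fin d → ℕ) × Finset (Pt d))) → Gen (PEv × β))
    (kdV : ℕ → ℝ → Finset ((Fin d → ℕ) × Gen PEv × Multiset (PEv × ((Fin d → ℕ) × Finset (Pt d)))) → SIdx I → ℝ)
    {kdDied kdMem kdInj kdV0 kdEnv kdW kdCN kdShare} :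
    (Dd.toLWK kdC kdN kdDec kdV kdDied kdMem kdInj kdV0 kdEnv kdW kdCN kdShare).ℛ = Dd.ℛ ∧
      (Dd.toLWK kdC kdN kdDec kdV kdDied kdMem kdInj kdV0 kdEnv kdW kdCN kdShare).K₀ = Dd.K₀ ∧
      (Dd.toLWK kdC kdN kdDec kdV kdDied kdMem kdInj kdV0 kdEnv kdW kdCN kdShare).Φf = Dd.Φf ∧
      (Dd.toLWK kdC kdN kdDec kdV kdDied kdMem kdInj kdV0 kdEnv kdW kdCN kdShare).l₀ = Dd.l₀ ∧
      (Dd.toLWK kdC kdN kdDec kdV kdDied kdMem kdInj kdV0 kdEnv kdW kdCN kdShare).W = Dd.W ∧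
      (Dd.toLWK kdC kdN kdDec kdV kdDied kdMem kdInj kdV0 kdEnv kdW kdCN kdShare).φB = Dd.φB ∧
      (Dd.toLWK kdC kdN kdDec kdV kdDied kdMem kdInj kdV0 kdEnv kdW kdCN kdShare).φR = Dd.φR ∧
      (Dd.toLWK kdC kdN kdDec kdV kdDied kdMem kdInj kdV0 kdEnv kdW kdCN kdShare).trunc = Dd.trunc ∧
      (Dd.toLWK kdC kdN kdDec kdV kdDied kdMem kdInj kdV0 kdEnv kdW kdCN kdShare).kdC = kdC ∧
      (Dd.toLWK kdC kdN kdDec kdV kdDied kdMem kdInj kdV0 kdEnv kdW kdCN kdShare).kdN = kdN ∧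
      (Dd.toLWK kdC kdN kdDec kdV kdDied kdMem kdInj kdV0 kdEnv kdW kdCN kdShare).kdDec = kdDec ∧
      (Dd.toLWK kdC kdN kdDec kdV kdDied kdMem kdInj kdV0 kdEnv kdW kdCN kdShare).kdV = kdV :=
  ⟨rfl, rfl, rfl, rfl, rfl, rfl, rfl, rfl, rfl, rfl, rfl, rfl⟩

/-! ## §12b «Mergers count at most one», from the share check as typed -/

/-- the sharp exponent of an event that is neither a birth nor a renewal is `0`, whatever the letters [folklore] -/
theorem sharpT_eq_zero_of_kind {sB : ℕ → ℕ → ℝ} {sR : ℕ → ℝ} {e : PEv} (h0 : e.kind ≠ 0) (h1 : e.kind ≠ 1) :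
    sharpT sB sR e = 0 := by
  unfold sharpT
  rw [if_neg h0, if_neg h1]

omit [RegularGaugeGroup G] in
/-- **MERGERS COUNT AT MOST ONE** on ANY key-side record: at an event of kind neither `0` (birth) nor `1` (renewal) the
share check `kdShare` reads `kdN K e ≤ exp 0 = 1`.  The merger normalisation of R-OWNER-50-1 (`N K (·,2,·) = 1`: «mergers
write nothing») is the MOST the record AS TYPED allows — a by-name consequence of FILE 1, no new hypothesis. [folklore] -/
theorem _root_.Summit.QuantumFields.BalabanUV.T4Continuum.HistoryRealiseCellsRunAssemblyWTVSDataLWK.HistReadDataLWK.kdN_le_one_of_merger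
    (Dd : HistReadDataLWK D C O θv rr d n hn g₀ os cΛ Lr Φ β₀ p₁ η η' κ κ₂ κᵥ β I I' Xs μ 𝒢 Y νB 𝒢') (K : ℕ) {e : PEv}
    (h0 : e.kind ≠ 0) (h1 : e.kind ≠ 1) : Dd.kdN K e ≤ 1 := by
  have h := Dd.kdShare K e
  rw [sharpT_eq_zero_of_kind h0 h1, Real.exp_zero] at h
  exact_mod_cast h

omit [RegularGaugeGroup G] in
/-- … hence, with the count display `kdCN`, every merger event of a member of a bad key class carries AT MOST ONE choice
word. [folklore] -/
theorem _root_.Summit.QuantumFields.BalabanUV.T4Continuum.HistoryRealiseCellsRunAssemblyWTVSDataLWK.HistReadDataLWK.card_kdC_le_one_of_merger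
    (Dd : HistReadDataLWK D C O θv rr d n hn g₀ os cΛ Lr Φ β₀ p₁ η η' κ κ₂ κᵥ β I I' Xs μ 𝒢 Y νB 𝒢') {K : ℕ} (hK : Dd.K₀ ≤ K)
    {k : Finset ((Fin d → ℕ) × Gen PEv × Multiset (PEv × ((Fin d → ℕ) × Finset (Pt d))))}
    (hk : k ∈ badGMems (memA n F.L Dd.ℛ) jhalf (HIndex.termSet I)
      (kmemA n F.L hn (lt_of_lt_of_le (by norm_num) (two_le_L F)) Dd.ℛ) K)
    {w : (Fin d → ℕ) × Gen PEv × Multiset (PEv × ((Fin d → ℕ) × Finset (Pt d)))} (hw : w ∈ k) {e : PEv}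
    (he : e ∈ w.2.1.events) (h0 : e.kind ≠ 0) (h1 : e.kind ≠ 1) : (Dd.kdC K w e).card ≤ 1 :=
  (Dd.kdCN K hK k hk w hw e he).trans (Dd.kdN_le_one_of_merger K h0 h1)

end Junction

end

end Summit.QuantumFields.BalabanUV.T4Continuum.HistoryRealiseCellsRunAssemblyWTVSSanity
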